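import Literature.Analysis.Complex.FourierPolyaKiKimCritical
import Literature.Analysis.TotalPositivity.PolyaFrequencyEntire
import Mathlib.Analysis.Complex.PhragmenLindelof
import Mathlib.Analysis.Complex.Liouville
import Mathlib.Analysis.Complex.TaylorSeries
import Mathlib.Analysis.MeanInequalitiesPow
import Mathlib.Analysis.SpecialFunctions.Pow.Complex
import HarnessLib

/-!
# Real entire functions of order `< 1` without real zeros have Fourier critical points

Support file (complex-variable part, 4/·) for the discharge of
`Literature.Analysis.Complex.KiKim2000_thm_4_3_noCriticalPoints`
(`Literature/Analysis/Complex/FourierPolyaKiKim.lean`): the analytic "engine" of Ki–Kim's §4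
(H. Ki, Y.-O. Kim, Duke Math. J. 104 (2000) 45–73, Lemmas 4.1–4.3 and the Proposition), in the
form needed for the case of NO critical points and for functions of order `< 1`
(`IsEntireOfOrderLt 1`, the class of `G` with `f(z) = G(z²)`, `f` even of order `< 2`).

## Main result

* `false_of_noCrit_of_forall_ne_zero`: a real entire `h` of order `< 1` with no real zeros
  cannot satisfy `HasNoFourierCriticalPoint (Re h|ℝ)`.

Printed route (Lemma 4.3): no critical points and no real zeros force all derivatives to be
zero-free on `ℝ` (each step: a real zero `a` of `h^{(n+1)}` is unique and a maximum of `|h^{(n)}|`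
by (3.1), so `h^{(n)}` is bounded on `ℝ`, impossible by Lemma 4.1 = Phragmén–Lindelöf); then the
signs can be normalised to `h^{(n)} > 0` ((4.2)), `h` is absolutely monotone on `(-∞, 0)`, and the
Bernstein–Widder representation contradicts growth `(1, 0)`. We follow this exactly, except that
the Bernstein–Widder theorem (not in Mathlib) is replaced by the elementary Taylor bound
`norm_le_re_of_absolutelyMonotone`: `‖F(x+iy)‖ ≤ Re F(x₀ + |x + iy - x₀|) → Re F(x)` as
`x₀ → -∞`, so `F` is bounded on the imaginary axis and `z ↦ F(iz)` is constant by
Phragmén–Lindelöf for order `< 1` (`eq_const_of_bounded_on_real_of_lt_one`, from Mathlib's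
quadrant theorems applied to `ζ ↦ F(ζ²)`).

## Contents (all proved)

* bridges `ℂ → ℝ` (with `Literature.Analysis.TotalPositivity.differentiable_iteratedDeriv`): `iteratedDeriv_re_ofReal`, `im_iteratedDeriv_ofReal_eq_zero`, `analyticAt_re_ofReal`;
* growth: `exists_growth_of_isEntireOfOrderLt_one`, `norm_deriv_le_of_growth_le_one`,
  `exists_growth_iteratedDeriv_of_lt_one`;
* Phragmén–Lindelöf: `norm_le_of_bounded_on_real_of_lt_one`, `eq_const_of_bounded_on_real_of_lt_one`;
* absolutely monotone functions: `norm_le_re_apply_of_nonneg_taylor`, `norm_le_re_of_absolutelyMonotone`;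
* signs of successive derivatives: `false_of_pos_of_deriv_pos_of_deriv_deriv_neg`, `sign_mul_sign_eq_of_derivs`;
* the engine `false_of_noCrit_of_forall_ne_zero`.

## References

* H. Ki, Y.-O. Kim, Duke Math. J. 104 (2000) 45–73, §4: Lemmas 4.1–4.3, (4.2), Proposition,
  pp. 57–60 [KiKim2000].
-/

noncomputable section

open Filter Set Topology
open scoped Topology

namespace Literature.Analysis.Complex
namespace KiKim



section engine

open _root_.Complex

/-! ## Real entire functions: the real-variable restriction -/

/-- The derivative of `t ↦ Re f(t)` along `ℝ` is `Re f'(t)` for `f` complex-differentiable. [folklore] -/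
theorem hasDerivAt_re_ofReal {f : ℂ → ℂ} {t : ℝ} (hf : DifferentiableAt ℂ f t) :
    HasDerivAt (fun s : ℝ => (f s).re) (deriv f t).re t :=
  hf.hasDerivAt.real_of_complex

/-- Iterated derivatives of the real restriction of an entire function:
`(Re f|ℝ)^{(n)}(t) = Re f^{(n)}(t)`. [folklore] -/
theorem iteratedDeriv_re_ofReal {f : ℂ → ℂ} (hf : Differentiable ℂ f) (n : ℕ) :
    iteratedDeriv n (fun s : ℝ => (f s).re) = fun t : ℝ => (iteratedDeriv n f t).re := by
  induction n with
  | zero => funext t; simp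
  | succ n ih =>
    funext t
    rw [iteratedDeriv_succ, ih, iteratedDeriv_succ]
    have hd : Differentiable ℂ (iteratedDeriv n f) := Literature.Analysis.TotalPositivity.differentiable_iteratedDeriv hf n
    exact (hasDerivAt_re_ofReal (hd.differentiableAt)).deriv

/-- The derivative of `t ↦ Im f(t)` along `ℝ` is `Im f'(t)`. [folklore] -/
theorem hasDerivAt_im_ofReal {f : ℂ → ℂ} {t : ℝ} (hf : DifferentiableAt ℂ f t) :
    HasDerivAt (fun s : ℝ => (f s).im) (deriv f t).im t := by
  have h1 : HasDerivAt (fun w => -I * f w) (-I * deriv f t) t := hf.hasDerivAt.const_mul (-I)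
  have h2 := h1.real_of_complex
  have e1 : (fun x : ℝ => ((-I) * f x).re) = fun s : ℝ => (f s).im := by
    funext x; simp
  have e2 : ((-I) * deriv f t).re = (deriv f t).im := by simp
  rwa [e1, e2] at h2

/-- Derivatives of a real entire function are real on `ℝ`. [folklore] -/
theorem im_iteratedDeriv_ofReal_eq_zero {f : ℂ → ℂ} (hf : Differentiable ℂ f)
    (hreal : ∀ x : ℝ, (f x).im = 0) (n : ℕ) (x : ℝ) : (iteratedDeriv n f x).im = 0 := by
  induction n generalizing x with
  | zero => simpa using hreal x
  | succ n ih =>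
    have hd : Differentiable ℂ (iteratedDeriv n f) := Literature.Analysis.TotalPositivity.differentiable_iteratedDeriv hf n
    rw [iteratedDeriv_succ]
    have h1 := hasDerivAt_im_ofReal (hd.differentiableAt (x := (x : ℂ)))
    have h2 : HasDerivAt (fun s : ℝ => (iteratedDeriv n f s).im) 0 x := by
      have : (fun s : ℝ => (iteratedDeriv n f s).im) = fun _ => 0 := funext fun s => ih s
      rw [this]; exact hasDerivAt_const x 0
    exact h1.unique h2

/-- The real restriction `t ↦ Re f(t)` of an entire function is real-analytic. [folklore] -/
theorem analyticAt_re_ofReal {f : ℂ → ℂ} (hf : Differentiable ℂ f) (x : ℝ) :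
    AnalyticAt ℝ (fun s : ℝ => (f s).re) x := by
  have h1 : AnalyticAt ℝ (fun s : ℝ => (s : ℂ)) x := Complex.ofRealCLM.analyticAt x
  have h2 : AnalyticAt ℝ f (x : ℂ) := (hf.analyticAt (x : ℂ)).restrictScalars
  have h3 : AnalyticAt ℝ (fun s : ℝ => f s) x := h2.comp h1
  exact (Complex.reCLM.analyticAt _).comp h3

/-! ## Entire functions of order `< 1` -/

/-- Normalised growth bound for `IsEntireOfOrderLt 1`: an exponent in `[0, 1)` and a constant
`≥ 1`. [folklore] -/
theorem exists_growth_of_isEntireOfOrderLt_one {f : ℂ → ℂ} (hf : IsEntireOfOrderLt 1 f) :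
    ∃ ρ C : ℝ, 0 ≤ ρ ∧ ρ < 1 ∧ 1 ≤ C ∧ ∀ z, ‖f z‖ ≤ C * Real.exp (‖z‖ ^ ρ) := by
  obtain ⟨hd, ρ, C, hρ, hgr⟩ := hf
  obtain ⟨M₀, hM₀⟩ := (isCompact_closedBall (0 : ℂ) 1).exists_bound_of_continuousOn
    hd.continuous.continuousOn
  refine ⟨max ρ 0, max (max |C| M₀) 1, le_max_right _ _, max_lt hρ one_pos, le_max_right _ _, fun z ↦ ?_⟩
  have hM₁ : max |C| M₀ ≤ max (max |C| M₀) 1 := le_max_left _ _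
  by_cases hz : ‖z‖ ≤ 1
  · calc ‖f z‖ ≤ M₀ := hM₀ z (Metric.mem_closedBall.mpr (by simpa using hz))
      _ ≤ M₀ * Real.exp (‖z‖ ^ max ρ 0) := by
          have hM : 0 ≤ M₀ := (norm_nonneg _).trans (hM₀ 0 (by simp))
          have : 1 ≤ Real.exp (‖z‖ ^ max ρ 0) := Real.one_le_exp (by positivity)
          nlinarith
      _ ≤ max (max |C| M₀) 1 * Real.exp (‖z‖ ^ max ρ 0) := by
          gcongr; exact (le_max_right _ _).trans hM₁
  · rw [not_le] at hz
    calc ‖f z‖ ≤ C * Real.exp (‖z‖ ^ ρ) := hgr z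
      _ ≤ |C| * Real.exp (‖z‖ ^ ρ) := by gcongr; exact le_abs_self C
      _ ≤ |C| * Real.exp (‖z‖ ^ max ρ 0) := by
          apply mul_le_mul_of_nonneg_left _ (abs_nonneg C)
          exact Real.exp_le_exp.mpr (Real.rpow_le_rpow_of_exponent_le hz.le (le_max_left _ _))
      _ ≤ max (max |C| M₀) 1 * Real.exp (‖z‖ ^ max ρ 0) := by
          gcongr; exact (le_max_left _ _).trans hM₁

/-- **The derivative of an entire function of order `≤ ρ ≤ 1` has the same growth**:
`‖f'‖ ≤ C e · exp(‖z‖^ρ)` from `‖f‖ ≤ C exp(‖z‖^ρ)` (Cauchy's estimate on the unit circle and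
`(r+1)^ρ ≤ r^ρ + 1`). [folklore] -/
theorem norm_deriv_le_of_growth_le_one {f : ℂ → ℂ} (hf : Differentiable ℂ f) {ρ C : ℝ}
    (hρ0 : 0 ≤ ρ) (hρ1 : ρ ≤ 1) (hC : 0 ≤ C) (hgr : ∀ z, ‖f z‖ ≤ C * Real.exp (‖z‖ ^ ρ)) (z : ℂ) :
    ‖deriv f z‖ ≤ (C * Real.exp 1) * Real.exp (‖z‖ ^ ρ) := by
  have h1 : ∀ w ∈ Metric.sphere z 1, ‖f w‖ ≤ C * Real.exp 1 * Real.exp (‖z‖ ^ ρ) := by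
    intro w hw
    refine (hgr w).trans ?_
    rw [mul_assoc, ← Real.exp_add]
    gcongr
    have hw' : ‖w‖ ≤ ‖z‖ + 1 := by
      have : ‖w - z‖ = 1 := by simpa [dist_eq_norm] using hw
      calc ‖w‖ = ‖(w - z) + z‖ := by ring_nf
        _ ≤ ‖w - z‖ + ‖z‖ := norm_add_le _ _
        _ = ‖z‖ + 1 := by rw [this, add_comm]
    calc ‖w‖ ^ ρ ≤ (‖z‖ + 1) ^ ρ := Real.rpow_le_rpow (norm_nonneg _) hw' hρ0
      _ ≤ ‖z‖ ^ ρ + (1:ℝ) ^ ρ := Real.rpow_add_le_add_rpow (norm_nonneg _) zero_le_one hρ0 hρ1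
      _ = 1 + ‖z‖ ^ ρ := by rw [Real.one_rpow, add_comm]
  have := Complex.norm_deriv_le_of_forall_mem_sphere_norm_le one_pos hf.diffContOnCl h1
  simpa using this

/-- Iterated derivatives of an entire function of order `< 1` are entire of order `< 1` (same
exponent). [folklore] -/
theorem exists_growth_iteratedDeriv_of_lt_one {f : ℂ → ℂ} (hf : Differentiable ℂ f) {ρ C : ℝ}
    (hρ0 : 0 ≤ ρ) (hρ1 : ρ < 1) (hC : 0 ≤ C) (hgr : ∀ z, ‖f z‖ ≤ C * Real.exp (‖z‖ ^ ρ)) (n : ℕ) :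
    ∃ C' : ℝ, 0 ≤ C' ∧ ∀ z, ‖iteratedDeriv n f z‖ ≤ C' * Real.exp (‖z‖ ^ ρ) := by
  induction n with
  | zero => exact ⟨C, hC, by simpa using hgr⟩
  | succ n ih =>
    obtain ⟨C', hC', h'⟩ := ih
    have hd : Differentiable ℂ (iteratedDeriv n f) := Literature.Analysis.TotalPositivity.differentiable_iteratedDeriv hf n
    refine ⟨C' * Real.exp 1, by positivity, fun z => ?_⟩
    rw [iteratedDeriv_succ]
    exact norm_deriv_le_of_growth_le_one hd hρ0 hρ1.le hC' h' z

/-- **Phragmén–Lindelöf for order `< 1`: an entire function of order `< 1` bounded on the real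
axis is bounded** (apply Mathlib's quadrant theorems to `ζ ↦ f(ζ²)`, which is bounded on both
boundary rays of the first and second quadrants and of growth `exp(|ζ|^{2ρ})`, `2ρ < 2`).
[folklore] -/
theorem norm_le_of_bounded_on_real_of_lt_one {f : ℂ → ℂ} (hf : Differentiable ℂ f) {ρ C M : ℝ}
    (hρ1 : ρ < 1) (hgr : ∀ z, ‖f z‖ ≤ C * Real.exp (‖z‖ ^ ρ))
    (hM : ∀ x : ℝ, ‖f x‖ ≤ M) (z : ℂ) : ‖f z‖ ≤ M := by
  set Q : ℂ → ℂ := fun ζ => f (ζ ^ 2) with hQ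
  have hQd : Differentiable ℂ Q := fun ζ => (hf (ζ ^ 2)).comp ζ (differentiableAt_pow 2)
  -- growth of `Q`
  have hQgr : ∀ ζ, ‖Q ζ‖ ≤ C * Real.exp (1 * ‖ζ‖ ^ (2 * ρ)) := by
    intro ζ
    rw [one_mul]
    refine (hgr (ζ ^ 2)).trans (le_of_eq ?_)
    congr 2
    rw [norm_pow, ← Real.rpow_natCast, ← Real.rpow_mul (norm_nonneg _)]
    norm_num
  have hO : ∀ S : Set ℂ, Q =O[Bornology.cobounded ℂ ⊓ 𝓟 S] fun z => Real.exp (1 * ‖z‖ ^ (2 * ρ)) := by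
    intro S
    apply Asymptotics.IsBigO.of_bound |C|
    filter_upwards with ζ
    rw [Real.norm_of_nonneg (Real.exp_pos _).le]
    exact (hQgr ζ).trans (mul_le_mul_of_nonneg_right (le_abs_self C) (Real.exp_pos _).le)
  have h2ρ : 2 * ρ < 2 := by linarith
  -- boundary values
  have hre : ∀ x : ℝ, ‖Q x‖ ≤ M := fun x => by
    simp only [hQ]; rw [show ((x : ℂ)) ^ 2 = ((x ^ 2 : ℝ) : ℂ) by push_cast; ring]; exact hM _
  have him : ∀ x : ℝ, ‖Q (x * I)‖ ≤ M := fun x => by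
    simp only [hQ]
    rw [show ((x : ℂ) * I) ^ 2 = ((-(x ^ 2) : ℝ) : ℂ) by push_cast; ring_nf; rw [Complex.I_sq]; ring]
    exact hM _
  have hQI : ∀ ζ : ℂ, 0 ≤ ζ.re → 0 ≤ ζ.im → ‖Q ζ‖ ≤ M := fun ζ h1 h2 =>
    PhragmenLindelof.quadrant_I hQd.diffContOnCl ⟨2 * ρ, h2ρ, 1, hO _⟩ (fun x _ => hre x)
      (fun x _ => him x) h1 h2
  have hQII : ∀ ζ : ℂ, ζ.re ≤ 0 → 0 ≤ ζ.im → ‖Q ζ‖ ≤ M := fun ζ h1 h2 =>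
    PhragmenLindelof.quadrant_II hQd.diffContOnCl ⟨2 * ρ, h2ρ, 1, hO _⟩ (fun x _ => hre x)
      (fun x _ => him x) h1 h2
  have hup : ∀ ζ : ℂ, 0 ≤ ζ.im → ‖Q ζ‖ ≤ M := fun ζ h =>
    (le_total 0 ζ.re).elim (fun h' => hQI ζ h' h) (fun h' => hQII ζ h' h)
  -- a square root of `z` in the closed upper half-plane
  set s : ℂ := z ^ ((2 : ℂ)⁻¹) with hs
  have hs2 : s ^ 2 = z := by rw [hs]; exact Complex.cpow_nat_inv_pow z two_ne_zero
  rcases le_total 0 s.im with h | h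
  · have := hup s h; rwa [hQ, show (fun ζ => f (ζ ^ 2)) s = f (s ^ 2) from rfl, hs2] at this
  · have h' : 0 ≤ (-s).im := by simpa using h
    have := hup (-s) h'
    rwa [hQ, show (fun ζ => f (ζ ^ 2)) (-s) = f ((-s) ^ 2) from rfl, neg_sq, hs2] at this

/-- An entire function of order `< 1` bounded on the real axis is constant. [folklore] -/
theorem eq_const_of_bounded_on_real_of_lt_one {f : ℂ → ℂ} (hf : Differentiable ℂ f) {ρ C M : ℝ}
    (hρ1 : ρ < 1) (hgr : ∀ z, ‖f z‖ ≤ C * Real.exp (‖z‖ ^ ρ))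
    (hM : ∀ x : ℝ, ‖f x‖ ≤ M) (z w : ℂ) : f z = f w := by
  refine hf.apply_eq_apply_of_bounded ?_ z w
  refine isBounded_iff_forall_norm_le.mpr ⟨M, ?_⟩
  rintro _ ⟨u, rfl⟩
  exact norm_le_of_bounded_on_real_of_lt_one hf hρ1 hgr hM u

/-! ## Absolutely monotone entire functions (replacing the Bernstein–Widder theorem) -/

/-- **Taylor bound with non-negative coefficients.** If `f` is entire, real on `ℝ`, and all
`Re f^{(n)}(x₀) ≥ 0`, then `‖f(z)‖ ≤ Re f(x₀ + ‖z - x₀‖)`. [folklore] -/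
theorem norm_le_re_apply_of_nonneg_taylor {f : ℂ → ℂ} (hf : Differentiable ℂ f)
    (hreal : ∀ x : ℝ, (f x).im = 0) {x₀ : ℝ} (hnn : ∀ n, 0 ≤ (iteratedDeriv n f x₀).re) (z : ℂ) :
    ‖f z‖ ≤ (f ((x₀ + ‖z - x₀‖ : ℝ) : ℂ)).re := by
  set r : ℝ := ‖z - (x₀ : ℂ)‖ with hr
  have hre : ∀ n, ((iteratedDeriv n f x₀).re : ℂ) = iteratedDeriv n f x₀ := by
    intro n
    apply Complex.ext
    · simp
    · simp only [Complex.ofReal_im]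
      exact (im_iteratedDeriv_ofReal_eq_zero hf hreal n x₀).symm
  have h1 := Complex.hasSum_taylorSeries_of_entire hf x₀ z
  have h2 := Complex.hasSum_taylorSeries_of_entire hf x₀ ((x₀ + r : ℝ) : ℂ)
  have h2' := Complex.hasSum_re h2
  refine HasSum.norm_le_of_bounded h1 h2' fun n => le_of_eq ?_
  have hsub : (((x₀ + r : ℝ) : ℂ) - x₀) = (r : ℂ) := by push_cast; ring
  rw [hsub, ← hre n]
  have e1 : (n.factorial : ℂ)⁻¹ • (r : ℂ) ^ n • ((iteratedDeriv n f x₀).re : ℂ) =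
      (((n.factorial : ℝ)⁻¹ * r ^ n * (iteratedDeriv n f x₀).re : ℝ) : ℂ) := by
    push_cast; simp only [smul_eq_mul]; ring
  rw [e1, Complex.ofReal_re]
  simp only [smul_eq_mul, norm_mul, norm_inv, Complex.norm_natCast, norm_pow, Complex.norm_real,
    Real.norm_eq_abs, abs_of_nonneg (hnn n), hr]
  ring

/-- The elementary limit behind Lemma AM: `√(h² + y²) - h → 0` as `h → +∞`, in the form
`x - h + √(h² + y²) → x`. [folklore] -/
theorem tendsto_sub_add_sqrt (x y : ℝ) :
    Tendsto (fun h : ℝ => x - h + Real.sqrt (h ^ 2 + y ^ 2)) atTop (𝓝 x) := by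
  have key : ∀ h : ℝ, 0 < h → x ≤ x - h + Real.sqrt (h ^ 2 + y ^ 2) ∧
      x - h + Real.sqrt (h ^ 2 + y ^ 2) ≤ x + y ^ 2 / (2 * h) := by
    intro h hh
    constructor
    · have : h ≤ Real.sqrt (h ^ 2 + y ^ 2) := by
        rw [show h = Real.sqrt (h ^ 2) by rw [Real.sqrt_sq hh.le]]
        exact Real.sqrt_le_sqrt (by nlinarith [Real.sqrt_sq hh.le])
      linarith
    · have : Real.sqrt (h ^ 2 + y ^ 2) ≤ h + y ^ 2 / (2 * h) := by
        rw [Real.sqrt_le_left (by positivity)]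
        have h2 : (h + y ^ 2 / (2 * h)) ^ 2 = h ^ 2 + y ^ 2 + (y ^ 2 / (2 * h)) ^ 2 := by
          field_simp; ring
        rw [h2]; nlinarith [sq_nonneg (y ^ 2 / (2 * h))]
      linarith
  have hlow : Tendsto (fun _ : ℝ => x) atTop (𝓝 x) := tendsto_const_nhds
  have hup : Tendsto (fun h : ℝ => x + y ^ 2 / (2 * h)) atTop (𝓝 x) := by
    have : Tendsto (fun h : ℝ => y ^ 2 / (2 * h)) atTop (𝓝 0) := by
      have h1 : Tendsto (fun h : ℝ => 2 * h) atTop atTop := Tendsto.const_mul_atTop two_pos tendsto_id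
      exact tendsto_const_nhds.div_atTop h1
    simpa using tendsto_const_nhds.add this
  refine tendsto_of_tendsto_of_tendsto_of_le_of_le' hlow hup ?_ ?_
  · filter_upwards [eventually_gt_atTop 0] with h hh using (key h hh).1
  · filter_upwards [eventually_gt_atTop 0] with h hh using (key h hh).2

/-- **Lemma AM (absolutely monotone real entire functions are dominated by their real values).**
If `f` is entire, real on `ℝ`, and `Re f^{(n)}(x) ≥ 0` for all `n` and all real `x`, then
`‖f(x + iy)‖ ≤ Re f(x)`: Taylor expansion at `x₀ → -∞` with non-negative coefficients. This
replaces the Bernstein–Widder representation used by Ki–Kim (Lemma 4.3). [folklore] -/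
theorem norm_le_re_of_absolutelyMonotone {f : ℂ → ℂ} (hf : Differentiable ℂ f)
    (hreal : ∀ x : ℝ, (f x).im = 0) (hnn : ∀ n, ∀ x : ℝ, 0 ≤ (iteratedDeriv n f x).re) (x y : ℝ) :
    ‖f (x + y * I)‖ ≤ (f x).re := by
  -- for every `h > 0`: `‖f(x+iy)‖ ≤ Re f(x - h + √(h² + y²))`
  have key : ∀ h : ℝ, 0 < h → ‖f (x + y * I)‖ ≤ (f ((x - h + Real.sqrt (h ^ 2 + y ^ 2) : ℝ) : ℂ)).re := by
    intro h hh
    have := norm_le_re_apply_of_nonneg_taylor hf hreal (x₀ := x - h) (hnn · (x - h)) (x + y * I)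
    have hn : ‖(x : ℂ) + y * I - ((x - h : ℝ) : ℂ)‖ = Real.sqrt (h ^ 2 + y ^ 2) := by
      rw [show (x : ℂ) + y * I - ((x - h : ℝ) : ℂ) = (h : ℂ) + y * I by push_cast; ring,
        Complex.norm_add_mul_I]
    rwa [hn] at this
  have hcont : Continuous fun s : ℝ => (f s).re :=
    Complex.continuous_re.comp (hf.continuous.comp Complex.continuous_ofReal)
  have hlim : Tendsto (fun h : ℝ => (f ((x - h + Real.sqrt (h ^ 2 + y ^ 2) : ℝ) : ℂ)).re) atTop
      (𝓝 ((f x).re)) := (hcont.tendsto x).comp (tendsto_sub_add_sqrt x y)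
  exact ge_of_tendsto hlim (by filter_upwards [eventually_gt_atTop 0] with h hh using key h hh)

end engine

section engine2

open _root_.Complex

/-! ## Sign patterns of successive derivatives (Ki–Kim 2000, proof of Lemma 4.3, (4.2)) -/

/-- **Lemma X.** There is no differentiable `F : ℝ → ℝ` with `F > 0`, `F' > 0` and `F'' < 0`
everywhere (a positive increasing concave function on the whole line). [folklore] -/
theorem false_of_pos_of_deriv_pos_of_deriv_deriv_neg {F : ℝ → ℝ} (hd : Differentiable ℝ F)
    (hd' : Differentiable ℝ (deriv F)) (h0 : ∀ x, 0 < F x) (h1 : ∀ x, 0 < deriv F x)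
    (h2 : ∀ x, deriv (deriv F) x < 0) : False := by
  set c := deriv F 0 with hc
  have hcpos : 0 < c := h1 0
  have hanti : Antitone (deriv F) := antitone_of_deriv_nonpos hd' fun x => (h2 x).le
  have key : ∀ x, x ≤ 0 → c * (0 - x) ≤ F 0 - F x := by
    intro x hx
    exact (convex_Iic (0:ℝ)).mul_sub_le_image_sub_of_le_deriv hd.continuous.continuousOn
      hd.differentiableOn (fun y hy => by
        rw [interior_Iic] at hy
        exact hanti (le_of_lt hy)) x (mem_Iic.mpr hx) 0 (mem_Iic.mpr le_rfl) hx
  have hx : -(F 0 / c + 1) ≤ 0 := by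
    have : 0 ≤ F 0 / c := div_nonneg (h0 0).le hcpos.le
    linarith
  have := key _ hx
  have h3 : c * (0 - -(F 0 / c + 1)) = F 0 + c := by field_simp; ring
  rw [h3] at this
  linarith [h0 (-(F 0 / c + 1))]

/-- The four forbidden sign patterns `(+,+,-), (-,-,+), (+,-,-), (-,+,+)` for `(G, G', G'')` of a
zero-free-derivatives function, in one statement: the sign products `s₀ s₁` and `s₁ s₂` agree.
[cite: KiKim2000, Lemma 4.3 (proof, (4.2))] -/
theorem sign_mul_sign_eq_of_derivs {G : ℝ → ℝ} (hG : ∀ x, AnalyticAt ℝ G x)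
    {s₀ s₁ s₂ : SignType} (h₀ : ∀ x, SignType.sign (G x) = s₀)
    (h₁ : ∀ x, SignType.sign (deriv G x) = s₁) (h₂ : ∀ x, SignType.sign (deriv (deriv G) x) = s₂)
    (hs₀ : s₀ ≠ 0) (hs₁ : s₁ ≠ 0) (hs₂ : s₂ ≠ 0) : s₀ * s₁ = s₁ * s₂ := by
  have hd : Differentiable ℝ G := fun x => (hG x).differentiableAt
  have hd' : Differentiable ℝ (deriv G) := fun x => (hG x).deriv.differentiableAt
  have hd'' : Differentiable ℝ (deriv (deriv G)) := fun x => (hG x).deriv.deriv.differentiableAt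
  -- values from signs
  have pos_of : ∀ {u : ℝ}, SignType.sign u = 1 → 0 < u := fun h => sign_eq_one_iff.mp h
  have neg_of : ∀ {u : ℝ}, SignType.sign u = -1 → u < 0 := fun h => sign_eq_neg_one_iff.mp h
  -- derivatives of the reflected / negated functions
  have dn : ∀ x, deriv (fun t => -G t) x = -deriv G x := fun x => deriv.fun_neg
  have dnn : ∀ x, deriv (deriv (fun t => -G t)) x = -deriv (deriv G) x := by
    intro x; rw [show deriv (fun t => -G t) = fun t => -deriv G t from funext dn]; exact deriv.fun_neg
  have dr : ∀ x, deriv (fun t => G (-t)) x = -deriv G (-x) := fun x => deriv_comp_neg G x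
  have drr : ∀ x, deriv (deriv (fun t => G (-t))) x = deriv (deriv G) (-x) := by
    intro x
    rw [show deriv (fun t => G (-t)) = fun t => -deriv G (-t) from funext dr, deriv.fun_neg,
      deriv_comp_neg (deriv G) x, neg_neg]
  have dnr : ∀ x, deriv (fun t => -G (-t)) x = deriv G (-x) := by
    intro x; rw [deriv.fun_neg, deriv_comp_neg G x, neg_neg]
  have dnrr : ∀ x, deriv (deriv (fun t => -G (-t))) x = -deriv (deriv G) (-x) := by
    intro x
    rw [show deriv (fun t => -G (-t)) = fun t => deriv G (-t) from funext dnr, deriv_comp_neg (deriv G) x]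
  rcases s₀ with _ | _ | _ <;> rcases s₁ with _ | _ | _ <;> rcases s₂ with _ | _ | _ <;>
    first
    | exact absurd rfl hs₀
    | exact absurd rfl hs₁
    | exact absurd rfl hs₂
    | decide
    | (exfalso
       -- (+,+,-)
       exact false_of_pos_of_deriv_pos_of_deriv_deriv_neg hd hd' (fun x => pos_of (h₀ x))
         (fun x => pos_of (h₁ x)) (fun x => neg_of (h₂ x)))
    | (exfalso
       -- (-,-,+): use `-G`
       refine false_of_pos_of_deriv_pos_of_deriv_deriv_neg (F := fun t => -G t) hd.neg
         (by rw [show deriv (fun t => -G t) = fun t => -deriv G t from funext dn]; exact hd'.neg)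
         (fun x => ?_) (fun x => ?_) (fun x => ?_)
       · have := neg_of (h₀ x); show 0 < -G x; linarith
       · rw [dn]; have := neg_of (h₁ x); linarith
       · rw [dnn]; have := pos_of (h₂ x); linarith)
    | (exfalso
       -- (+,-,-): use `G(-t)`
       refine false_of_pos_of_deriv_pos_of_deriv_deriv_neg (F := fun t => G (-t))
         (hd.comp differentiable_neg)
         (by rw [show deriv (fun t => G (-t)) = fun t => -deriv G (-t) from funext dr]
             exact (hd'.comp differentiable_neg).neg)
         (fun x => ?_) (fun x => ?_) (fun x => ?_)
       · exact pos_of (h₀ (-x))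
       · rw [dr]; have := neg_of (h₁ (-x)); linarith
       · rw [drr]; exact neg_of (h₂ (-x)))
    | (exfalso
       -- (-,+,+): use `-G(-t)`
       refine false_of_pos_of_deriv_pos_of_deriv_deriv_neg (F := fun t => -G (-t))
         ((hd.comp differentiable_neg).neg)
         (by rw [show deriv (fun t => -G (-t)) = fun t => deriv G (-t) from funext dnr]
             exact hd'.comp differentiable_neg)
         (fun x => ?_) (fun x => ?_) (fun x => ?_)
       · have := neg_of (h₀ (-x)); show 0 < -G (-x); linarith
       · rw [dnr]; exact pos_of (h₁ (-x))
       · rw [dnrr]; have := pos_of (h₂ (-x)); linarith)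

end engine2

section engine3

open _root_.Complex

/-- Sign of a cast sign. [folklore] -/
theorem sign_coe_signType (s : SignType) : SignType.sign ((s : ℝ)) = s := by
  rcases s with _ | _ | _ <;> simp

/-- A non-zero sign squares to `1`. [folklore] -/
theorem signType_mul_self {s : SignType} (hs : s ≠ 0) : s * s = 1 := by
  rcases s with _ | _ | _
  · exact absurd rfl hs
  · decide
  · decide

/-- A non-zero sign is `±1` as a real number. [folklore] -/
theorem signType_coe_real_eq_or {s : SignType} (hs : s ≠ 0) : (s : ℝ) = 1 ∨ (s : ℝ) = -1 := by
  rcases s with _ | _ | _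
  · exact absurd rfl hs
  · right; simp
  · left; simp

/-- **The engine (Ki–Kim 2000, Lemmas 4.1–4.3 in the case of no critical points, for order `< 1`,
with the Bernstein–Widder theorem replaced by `norm_le_re_of_absolutelyMonotone`).** A real entire
function `h` of order `< 1` without real zeros cannot satisfy `H` (no Fourier critical points):

1. under `H`, if `h^{(n)}` has no real zero then neither has `h^{(n+1)}` — a real zero `a` of
   `h^{(n+1)}` would be the only one and a maximum of `|h^{(n)}|` (`bounded_of_forall_deriv_zero_mul_lt`),
   so `h^{(n)}` would be bounded on `ℝ`, hence constant by Phragmén–Lindelöf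
   (`eq_const_of_bounded_on_real_of_lt_one`), contradicting `h^{(n)}(a) h^{(n+2)}(a) < 0`;
2. the signs `sₙ` of `h^{(n)}` on `ℝ` then satisfy `sₙ sₙ₊₁ = sₙ₊₁ sₙ₊₂` (`sign_mul_sign_eq_of_derivs`),
   so `F(z) = s₀ h(s₀ s₁ z)` has `F^{(n)} > 0` on `ℝ` for all `n` ((4.2));
3. `‖F(iy)‖ ≤ F(0)` (`norm_le_re_of_absolutelyMonotone`), so `z ↦ F(iz)` is bounded on `ℝ`,
   hence constant — but `h' ≠ 0`.
[cite: KiKim2000, Lemmas 4.1–4.3] -/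
theorem false_of_noCrit_of_forall_ne_zero {h : ℂ → ℂ} (hh : IsEntireOfOrderLt 1 h)
    (hreal : ∀ x : ℝ, (h x).im = 0) (h0 : ∀ x : ℝ, h x ≠ 0)
    (hH : HasNoFourierCriticalPoint (fun t : ℝ => (h t).re)) : False := by
  obtain ⟨ρ, C, hρ0, hρ1, hC1, hgr⟩ := exists_growth_of_isEntireOfOrderLt_one hh
  have hd : Differentiable ℂ h := hh.1
  set hR : ℝ → ℝ := fun t => (h t).re with hRdef
  have hRa : ∀ x, AnalyticAt ℝ hR x := analyticAt_re_ofReal hd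
  have hDer : ∀ n, iteratedDeriv n hR = fun t : ℝ => (iteratedDeriv n h t).re := iteratedDeriv_re_ofReal hd
  have hDn : ∀ n, Differentiable ℂ (iteratedDeriv n h) := Literature.Analysis.TotalPositivity.differentiable_iteratedDeriv hd
  have hgrn := exists_growth_iteratedDeriv_of_lt_one hd hρ0 hρ1 (by linarith) hgr
  have himn : ∀ n (x : ℝ), (iteratedDeriv n h x).im = 0 := im_iteratedDeriv_ofReal_eq_zero hd hreal
  have hcast : ∀ n (x : ℝ), iteratedDeriv n h x = ((iteratedDeriv n hR x : ℝ) : ℂ) := by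
    intro n x
    apply Complex.ext
    · simp [hDer]
    · simp [himn]
  have hAn : ∀ n x, AnalyticAt ℝ (iteratedDeriv n hR) x := analyticAt_iteratedDeriv hRa
  /- Step 1: no derivative of `hR` has a real zero. -/
  have S1 : ∀ n, ∀ x, iteratedDeriv n hR x ≠ 0 := by
    intro n
    induction n with
    | zero =>
      intro x hx
      apply h0 x
      apply Complex.ext
      · simpa [hRdef] using hx
      · simpa using hreal x
    | succ n ih =>
      intro a ha
      set G := iteratedDeriv n hR with hG
      have ha' : deriv G a = 0 := by rw [hG, deriv_iteratedDeriv]; exact ha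
      have hall : ∀ c, deriv G c = 0 → G c * deriv (deriv G) c < 0 := by
        intro c hc
        rw [hG, deriv_iteratedDeriv] at hc ⊢
        rw [deriv_iteratedDeriv]
        exact hH n c hc (ih c)
      have hb := bounded_of_forall_deriv_zero_mul_lt (hAn n) ih hall ha'
      obtain ⟨C', hC', hgr'⟩ := hgrn n
      have hM : ∀ x : ℝ, ‖iteratedDeriv n h x‖ ≤ |G a| := by
        intro x
        rw [hcast n x, Complex.norm_real, Real.norm_eq_abs]
        exact hb x
      have hconst := eq_const_of_bounded_on_real_of_lt_one (hDn n) hρ1 hgr' hM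
      have h2 : deriv (deriv G) a = 0 := by
        rw [hG, deriv_iteratedDeriv, deriv_iteratedDeriv, hDer]
        have hc : iteratedDeriv n h = fun _ => iteratedDeriv n h 0 := funext fun z => hconst z 0
        have : iteratedDeriv (n + 1 + 1) h = 0 := by
          funext z
          rw [iteratedDeriv_succ, iteratedDeriv_succ, hc]; simp
        simp [this]
      have := hall a ha'
      rw [h2, mul_zero] at this
      exact lt_irrefl 0 this
  /- Step 2: the signs of the derivatives and the recursion `sₙ sₙ₊₁ = sₙ₊₁ sₙ₊₂`. -/
  set s : ℕ → SignType := fun n => SignType.sign (iteratedDeriv n hR 0) with hs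
  have hs0 : ∀ n, s n ≠ 0 := fun n => sign_ne_zero.mpr (S1 n 0)
  have hsx : ∀ n x, SignType.sign (iteratedDeriv n hR x) = s n := fun n x =>
    sign_eq_sign_of_forall_ne_zero (continuous_iff_continuousAt.mpr fun y => (hAn n y).continuousAt)
      (S1 n) x 0
  have hrec : ∀ n, s n * s (n + 1) = s (n + 1) * s (n + 2) := by
    intro n
    refine sign_mul_sign_eq_of_derivs (hAn n) (hsx n) (fun x => ?_) (fun x => ?_) (hs0 n) (hs0 (n + 1))
      (hs0 (n + 2))
    · rw [deriv_iteratedDeriv]; exact hsx (n + 1) x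
    · rw [deriv_iteratedDeriv, deriv_iteratedDeriv]; exact hsx (n + 2) x
  obtain ⟨u, hu⟩ : ∃ u : SignType, s 0 * s 1 = u := ⟨_, rfl⟩
  have hsq : ∀ n, s n * s n = 1 := fun n => signType_mul_self (hs0 n)
  have hsn : ∀ n, s n = u ^ n * s 0 := by
    intro n
    induction n with
    | zero => simp
    | succ n ih =>
      -- `s (n+1) = (s n s (n+1)) s n = u s n`
      have hp : ∀ m, s m * s (m + 1) = u := by
        intro m; induction m with
        | zero => exact hu
        | succ m ihm => rw [← ihm]; exact (hrec m).symm
      calc s (n + 1) = s (n + 1) * (s n * s n) := by rw [hsq n, mul_one]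
        _ = (s n * s (n + 1)) * s n := by rw [← mul_assoc, mul_comm (s (n + 1)) (s n)]
        _ = u * (u ^ n * s 0) := by rw [hp n, ih]
        _ = u ^ (n + 1) * s 0 := by rw [pow_succ, mul_comm (u ^ n) u, mul_assoc]
  /- Step 3: the absolutely monotone function `F(z) = s₀ h(u z)`. -/
  set ε : ℝ := (s 0 : ℝ) with hε
  set υ : ℝ := (u : ℝ) with hυ
  have hε1 : ε = 1 ∨ ε = -1 := signType_coe_real_eq_or (hs0 0)
  have hu0 : u ≠ 0 := by rw [← hu]; exact mul_ne_zero (hs0 0) (hs0 1)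
  have hu2 : u * u = 1 := signType_mul_self hu0
  have hυ1 : υ = 1 ∨ υ = -1 := signType_coe_real_eq_or hu0
  have hυabs : ‖(υ : ℂ)‖ = 1 := by rcases hυ1 with e | e <;> simp [e]
  have hεabs : ‖(ε : ℂ)‖ = 1 := by rcases hε1 with e | e <;> simp [e]
  have hυne : (υ : ℂ) ≠ 0 := norm_ne_zero_iff.mp (by rw [hυabs]; norm_num)
  have hεne : (ε : ℂ) ≠ 0 := norm_ne_zero_iff.mp (by rw [hεabs]; norm_num)
  set F : ℂ → ℂ := fun z => (ε : ℂ) * h ((υ : ℂ) * z) with hF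
  have hFd : Differentiable ℂ F := by
    intro z; simp only [hF]; fun_prop
  have hFgr : ∀ z, ‖F z‖ ≤ C * Real.exp (‖z‖ ^ ρ) := by
    intro z
    simp only [hF, norm_mul, hεabs, one_mul]
    have := hgr ((υ : ℂ) * z)
    rwa [norm_mul, hυabs, one_mul] at this
  have hFreal : ∀ x : ℝ, (F x).im = 0 := by
    intro x
    simp only [hF]
    rw [show (υ : ℂ) * (x : ℂ) = ((υ * x : ℝ) : ℂ) by push_cast; ring]
    rw [Complex.mul_im, Complex.ofReal_re, Complex.ofReal_im, hreal]
    ring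
  have hdc : Differentiable ℂ (fun z => h ((υ : ℂ) * z)) := hd.comp (differentiable_id.const_mul _)
  have hFder : ∀ n (x : ℝ), iteratedDeriv n F x = (ε : ℂ) * ((υ : ℂ) ^ n * iteratedDeriv n h ((υ : ℂ) * x)) := by
    intro n x
    simp only [hF]
    rw [iteratedDeriv_const_mul (ε : ℂ) (hdc.contDiff.contDiffAt)]
    congr 1
    have := iteratedDeriv_comp_const_mul (n := n) (hd.contDiff) (υ : ℂ)
    exact congr_fun this x
  have hFnn : ∀ n (x : ℝ), 0 ≤ (iteratedDeriv n F x).re := by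
    intro n x
    rw [hFder, show (υ : ℂ) * (x : ℂ) = ((υ * x : ℝ) : ℂ) by push_cast; ring, hcast n,
      show (ε : ℂ) * ((υ : ℂ) ^ n * ((iteratedDeriv n hR (υ * x) : ℝ) : ℂ)) =
        ((ε * (υ ^ n * iteratedDeriv n hR (υ * x)) : ℝ) : ℂ) by push_cast; ring, Complex.ofReal_re]
    apply le_of_lt
    apply sign_eq_one_iff.mp
    rw [sign_mul, sign_mul, sign_pow, hsx n, hε, hυ, sign_coe_signType, sign_coe_signType, hsn n]
    have key : ∀ a b : SignType, a * (b * (b * a)) = (a * a) * (b * b) := by decide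
    rw [key, hsq 0, one_mul, ← mul_pow, hu2, one_pow]
  /- Step 4: `F` is bounded on the imaginary axis, hence `z ↦ F(iz)` is constant. -/
  have hAM : ∀ y : ℝ, ‖F (y * I)‖ ≤ (F 0).re := by
    intro y
    have := norm_le_re_of_absolutelyMonotone hFd hFreal hFnn 0 y
    simpa using this
  set K : ℂ → ℂ := fun z => F (I * z) with hK
  have hKd : Differentiable ℂ K := by intro z; simp only [hK]; fun_prop
  have hKgr : ∀ z, ‖K z‖ ≤ C * Real.exp (‖z‖ ^ ρ) := by
    intro z
    have := hFgr (I * z)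
    rwa [show ‖I * z‖ = ‖z‖ by rw [norm_mul, Complex.norm_I, one_mul]] at this
  have hKM : ∀ x : ℝ, ‖K x‖ ≤ (F 0).re := fun x => by
    simp only [hK]; rw [mul_comm]; exact hAM x
  have hKc := eq_const_of_bounded_on_real_of_lt_one hKd hρ1 hKgr hKM
  /- Step 5: so `h` is constant, contradicting `h' ≠ 0` on `ℝ`. -/
  have hhc : ∀ z, h z = h 0 := by
    intro z
    have e1 : F ((υ : ℂ)⁻¹ * z) = F 0 := by
      have := hKc (-I * ((υ : ℂ)⁻¹ * z)) 0
      simp only [hK] at this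
      rwa [← mul_assoc, show I * -I = 1 by rw [mul_neg, Complex.I_mul_I, neg_neg], one_mul,
        mul_zero] at this
    simp only [hF] at e1
    rw [← mul_assoc, mul_inv_cancel₀ hυne, one_mul, mul_zero] at e1
    exact mul_left_cancel₀ hεne e1
  have h1 : iteratedDeriv 1 hR 0 = 0 := by
    rw [hDer]
    simp only [iteratedDeriv_one]
    rw [show h = fun _ => h 0 from funext hhc]
    simp
  exact S1 1 0 h1

end engine3

end KiKim
end Literature.Analysis.Complex
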